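/-
Origin: expansion seat `prover-pub-hodgecm-mc-sinst-1-g3-0`, handover #1214 2026-08-20T06:48Z md5 fd5b2bcd86a6 (245 l.) NEW additive drop-alone leaf after RUN-42 #1213 (landed) + installed HypCensus/TorusChart + ArchKTypeOfArch; (J-μ) in ARCHIMEDEAN currency: cmSeesawElement_eq_one (the plane's see-saw element at g = 1, C = 1 is 1), cmLineTensorFin_eq_reindex_tensorToSum (φ₀ ⊗″ φ₁ = R_e R_f⁻¹ (R⁻¹φ₀ ⊠ R⁻¹φ₁), no Weil operator), cmPlaneTorusIdeles_inf_eq_archToAdelic (S-side torus element = archToAdelic (archDiag (dW S) (t₀,t₁)), rfl-level bridge PerL34 ↔ Literature tori), cmPairRep_planeTorus_eq_adelicTensorEnd (ω(1, diag(t₀,t₁)_𝔸) = ω_∞(1, archDiag) ⊗ 1), slotArchBox + exists_cmLineTensorFin_testFun_eq_tmul (X = E(slotArchBox Φ₀ Φ₁ ⊗ f)), cmPairRep_planeTorus_lineTensorFin_of_arch_eigen, slotType_eq_of_arch_eigen, ctxSlotArchBox, slotTypeVec_sub_eq_of_arch_eigen (hΔ₁'s left side from ∀ t₀ t₁, ω_∞(1,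 archDiag (dW c.D) (t₀,t₁)) Φ_X = (archWeight m₀ t₀ · archWeight m₁ t₁) • Φ_X at Φ_X = slotArchBox linePhi₀ linePhi₁); install AFTER #1213; drop alone on bounce; NAME LIST: HodgeCM.Model.ArchSideTerm.cmSeesawElement_eq_one · HodgeCM.Model.ArchSideTerm.cmLineTensorFin_eq_reindex_tensorToSum · HodgeCM.Model.ArchSideTerm.cmPlaneTorusIdeles_inf_eq_archToAdelic · HodgeCM.Model.ArchSideTerm.cmPairRep_planeTorus_eq_adelicTensorEnd · HodgeCM.Model.ArchSideTerm.slotArchBox · HodgeCM.Model.ArchSideTerm.exists_cmLineTensorFin_testFun_eq_tmul · HodgeCM.Model.ArchSideTerm.cmPairRep_planeTorus_lineTensorFin_of_arch_eigen · HodgeCM.Model.ArchSideTerm.slotType_eq_of_arch_eigen · HodgeCM.Model.ArchSideTerm.ctxSlotArchBox · HodgeCM.Model.ArchSideTerm.slotTypeVec_sub_eq_of_arch_eigen (`HOME/mc/pub-hodgecm-mc-sinst-1-g3/stage/HodgeCM/Model/ArchLineSlotTypeArch.lean`, md5 fd5b2bcd86a6, 245 lines);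
landed by the gen-16 packager (p-g16) in gate run 43 as `HodgeCM/Model/ArchLineSlotTypeArch.lean` (verbatim).
-/
/-
Origin: speedrun cell pub-hodgecm, MODEL-CONSTRUCTION sub-cell, lineage mc-sinst-1 (S-instance constructor, BINDER-OWNERS row 5 `S` / row 6 `μ`: (J-μ)),
seat prover-pub-hodgecm-mc-sinst-1-g3-0 (gen 3), 2026-08-20.  Target in PKG: `HodgeCM/Model/ArchLineSlotTypeArch.lean`
(NEW additive drop-alone leaf; RUN 43 material; imports RUN-42 #1213 `Model/ArchLineSlotTypeEigen` + installed `Model/HypCensus/TorusChart` (binder-2 #25)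
+ `Model/ArchKTypeOfArch` (carch-1)).
KERNEL only: 0 records / `def … : Prop` / cites, 0 proof holes; intended closure {propext, Classical.choice, Quot.sound}.
-/
import Summits.HodgeConjecture.HodgeCM.Model.ArchLineSlotTypeEigen
import Summits.HodgeConjecture.HodgeCM.Model.HypCensus.TorusChart
import Summits.HodgeConjecture.HodgeCM.Model.ArchKTypeOfArch

/-!
# (J-μ) IN ARCHIMEDEAN CURRENCY: the plane slot types from ONE eigen-identity of binder-2's `ω_∞(1, archDiag u)`

#1213 reads the two plane slot types off an eigen-identity of the ADELIC big pair `cmPairRep … (1, diag(t₀,t₁)_𝔸)` on the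
see-saw tensor `X = φ_N(Φ₀) ⊗″ φ_N(Φ₁)`.  This leaf strips everything adelic from that hypothesis:

* §1 `cmSeesawElement_eq_one`: the see-saw element of the plane `diag(a₀,a₁) = ⟨a₀⟩ ⊕ ⟨a₁⟩` (`g = 1`, `C = 1`) is `1`, hence
  **`cmLineTensorFin_eq_reindex_tensorToSum`**: `φ₀ ⊗″ φ₁ = R_e (R_f⁻¹ (R_{e₁}⁻¹ φ₀ ⊠ R_{e₁}⁻¹ φ₁))` — NO Weil operator, a reindexed box tensor;
* §2 **`cmPlaneTorusIdeles_inf_eq_archToAdelic`**: the S-side torus element `diag(t₀,t₁)_𝔸` IS binder-2's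
  `archToAdelic (archDiag (dW S) (t₀,t₁))` (`TorusChart.cmAdelicEquiv_jT_toAdeles` + the vendored junction
  `cmAdelicEquiv_eq_cmPlaneTorusIdeles`), hence **`cmPairRep_planeTorus_eq_adelicTensorEnd`**:
  `cmPairRep (1, diag(t₀,t₁)_𝔸) = ω_∞(1, archDiag (t₀,t₁)) ⊗ 1` (carch-1 `cmPairRep_archToAdelic_eq_adelicTensorEnd`);
* §3 `slotArchBox Φ₀ Φ₁` — the archimedean factor of `X` (the reindexed Schwartz box `⊠_∞`) — and
  **`exists_cmLineTensorFin_testFun_eq_tmul`**: `X = E (slotArchBox Φ₀ Φ₁ ⊗ f)` for some finite factor `f`;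
* §4 **`cmPairRep_planeTorus_lineTensorFin_of_arch_eigen`**: an eigen-identity of `ω_∞(1, archDiag (dW S) (t₀,t₁))` on
  `slotArchBox Φ₀ Φ₁` IS #1213's hypothesis `h`; **`slotType_eq_of_arch_eigen`**, **`slotTypeVec_sub_eq_of_arch_eigen`** — the (J-μ)
  residual `slotTypeVec 1 − slotTypeVec 0 = m₁ − m₀` from `∀ t₀ t₁, ω_∞(1, archDiag (t₀,t₁)) Φ_X = (archWeight m₀ t₀ · archWeight m₁ t₁) • Φ_X`
  at `Φ_X = slotArchBox (linePhi₀) (linePhi₁)` — a statement inside binder-2's engine (`TorusLetters` / `OmgInsTorus` / (CF)).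
Nothing here is a claim of PerL/QW8; kernel analysis over the tree's constructed objects.
-/

set_option autoImplicit false

noncomputable section

open scoped Matrix Classical SchwartzMap TensorProduct
open NumberField.mixedEmbedding (mixedSpace)
open Literature.NumberTheory.Automorphic Literature.NumberTheory.Automorphic.UnitaryGroup Literature.NumberTheory.Weil1964
open Literature.NumberTheory.GelbartRogawski1991 Literature.NumberTheory.GelbartRogawski1991.UnitaryDualPair
open HodgeCM.Adelic HodgeCM.PerL34 HodgeCM.PerL34.TorusEmbedding

namespace HodgeCM.Model.ArchSideTerm

/-! ## § 1 the see-saw element of the plane is trivial; `⊗″` is the reindexed box tensor -/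

section SeesawOne

variable (L : Type) [Field L] [NumberField L] [NumberField.IsCMField L] {N : ℕ}
variable (dV : Fin N → L) (hdV : ∀ i, NumberField.IsCMField.complexConj L (dV i) = dV i)
variable (a : Fin 2 → L) (ha : ∀ i, NumberField.IsCMField.complexConj L (a i) = a i)

/-- **the see-saw element of the plane `diag(a₀,a₁) = ⟨a₀⟩ ⊕ ⟨a₁⟩` (`g = 1`, `C = 1`) is the identity.** -/
theorem cmSeesawElement_eq_one :
    seesawElement (↥(NumberField.maximalRealSubfield L)) L (NumberField.IsCMField.complexConj L) N 1 1 (Matrix.diagonal dV)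
      (Matrix.diagonal a) (Matrix.diagonal (lineVec L (a 0))) (Matrix.diagonal (lineVec L (a 1)))
      (complexConj_imagUnit L) (imagUnit_ne_zero L) (imagUnit_mul_self L)
      (realDiagonal_isSymm L dV hdV) (realDiagonal_isSymm L a ha)
      (realDiagonal_isSymm L (lineVec L (a 0)) fun _ => ha 0) (realDiagonal_isSymm L (lineVec L (a 1)) fun _ => ha 1)
      (realDiagonal_map L dV hdV).symm (realDiagonal_map L a ha).symm
      (realDiagonal_map L (lineVec L (a 0)) fun _ => ha 0).symm (realDiagonal_map L (lineVec L (a 1)) fun _ => ha 1).symm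
      (adelicIsometry_one_lineVec L a) (gramIntertwiner_one_lineVec L a ha (realDiagonal L dV hdV)) = 1 := by
  apply Subtype.ext
  refine LinearEquiv.ext fun x => ?_
  rw [seesawElement, coe_adelicSeesawConj]
  simp

end SeesawOne

section Plane

variable {L : CMField} {ι₁ : L →+* ℂ} (V : HermSpace3 L ι₁) (S : StubTree.SeesawDatum L)
variable
  (hGR : (cmSplittingDatum (L : Type) finProdFinEquiv (frameD V) (frameD_real V) (frameD_ne V) (dW S) (dW_real S) (dW_ne S)).CompatibleSplitting)
  (hGR₀ : (cmSplittingDatum (L : Type) (e₁) (frameD V) (frameD_real V) (frameD_ne V) (lineVec (L : Type) (dW S 0))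
    (fun _ => dW_real S 0) (fun _ => dW_ne S 0)).CompatibleSplitting)
  (hGR₁ : (cmSplittingDatum (L : Type) (e₁) (frameD V) (frameD_real V) (frameD_ne V) (lineVec (L : Type) (dW S 1))
    (fun _ => dW_real S 1) (fun _ => dW_ne S 1)).CompatibleSplitting)

/-- (Ported verbatim from the HodgeCMPerL package; no docstring in the source.) -/
private theorem mk_one_eq_one {G : Type*} [Group G] (H : Subgroup G) (h : (1 : G) ∈ H) : (⟨1, h⟩ : ↥H) = 1 := rfl

/-- **`⊗″` on the plane is the plain reindexed box tensor**: `φ₀ ⊗″ φ₁ = R_e (R_f⁻¹ (R_{e₁}⁻¹ φ₀ ⊠ R_{e₁}⁻¹ φ₁))`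
(`e = finProdFinEquiv`, `f = finProdSumEquiv 3 1 1`): the Weil operator of the see-saw element is the identity. -/
theorem cmLineTensorFin_eq_reindex_tensorToSum (φ₀ φ₁ : piSchwartzBruhat (↥(NumberField.maximalRealSubfield (L : Type))) (Fin 3)) :
    cmLineTensorFin (L : Type) finProdFinEquiv e₁ (frameD V) (frameD_real V) (frameD_ne V) (dW S) (dW_real S) (dW_ne S) φ₀ φ₁ =
      piSBReindex (↥(NumberField.maximalRealSubfield (L : Type))) finProdFinEquiv
        ((piSBReindex (↥(NumberField.maximalRealSubfield (L : Type))) (finProdSumEquiv 3 1 1)).symm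
          (tensorToSum (↥(NumberField.maximalRealSubfield (L : Type))) (Fin 3 × Fin 1) (Fin 3 × Fin 1)
            ((piSBReindex (↥(NumberField.maximalRealSubfield (L : Type))) e₁).symm φ₀) ((piSBReindex (↥(NumberField.maximalRealSubfield (L : Type))) e₁).symm φ₁))) := by
  rw [cmLineTensorFin_apply, cmLineTensor, seesawConjTensor_apply]
  simp only [cmSeesawElement_eq_one, mk_one_eq_one, map_one, Module.End.one_apply]

/-! ## § 2 the S-side plane torus element is binder-2's archimedean torus element -/

/-- **`diag(t₀,t₁)_𝔸 = archToAdelic (archDiag (dW S) (t₀,t₁))`** (`TorusChart.cmAdelicEquiv_jT_toAdeles` + `cmAdelicEquiv_eq_cmPlaneTorusIdeles`). -/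
theorem cmPlaneTorusIdeles_inf_eq_archToAdelic (t₀ t₁ : ↥(relNormOneInfUnits (↥(NumberField.maximalRealSubfield (L : Type))) (L : Type))) :
    cmPlaneTorusIdeles (L : Type) (dW S)
        (relNormOneInfToIdeles (↥(NumberField.maximalRealSubfield (L : Type))) (L : Type) t₀, relNormOneInfToIdeles (↥(NumberField.maximalRealSubfield (L : Type))) (L : Type) t₁) =
      archToAdelic (↥(NumberField.maximalRealSubfield (L : Type))) (L : Type) (NumberField.IsCMField.complexConj (L : Type)) 2 (Matrix.diagonal (dW S))
        (HypCensus.archDiag (L : Type) (dW S) (NumberField.SeesawArchTorus.mk (L : Type) t₀ t₁)) := by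
  rw [← HypCensus.cmAdelicEquiv_jT_toAdeles]
  refine (cmAdelicEquiv_eq_cmPlaneTorusIdeles (L : Type) (dW S) _ _ _ ?_).symm
  rw [coe_jT, val_toGL]
  rfl

/-- **`ω(1, diag(t₀,t₁)_𝔸) = ω_∞(1, archDiag (t₀,t₁)) ⊗ 1`** on `𝒮(𝔸^6)`: the big pair's plane torus acts through the archimedean
factor, by binder-2's `cmArchWeilRep` (carch-1 `cmPairRep_archToAdelic_eq_adelicTensorEnd`). -/
theorem cmPairRep_planeTorus_eq_adelicTensorEnd (t₀ t₁ : ↥(relNormOneInfUnits (↥(NumberField.maximalRealSubfield (L : Type))) (L : Type))) :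
    cmPairRep (L : Type) finProdFinEquiv (frameD V) (frameD_real V) (frameD_ne V) (dW S) (dW_real S) (dW_ne S) hGR
        (1, cmPlaneTorusIdeles (L : Type) (dW S)
          (relNormOneInfToIdeles (↥(NumberField.maximalRealSubfield (L : Type))) (L : Type) t₀,
            relNormOneInfToIdeles (↥(NumberField.maximalRealSubfield (L : Type))) (L : Type) t₁)) =
      adelicTensorEnd
        (HypCensus.cmArchWeilRep (L : Type) finProdFinEquiv (frameD V) (frameD_real V) (frameD_ne V) (dW S) (dW_real S) (dW_ne S) hGR
            (1, HypCensus.archDiag (L : Type) (dW S) (NumberField.SeesawArchTorus.mk (L : Type) t₀ t₁)) :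
          𝓢((Fin (3 * 2) → mixedSpace (↥(NumberField.maximalRealSubfield (L : Type)))), ℂ) →ₗ[ℂ] _)
        LinearMap.id := by
  rw [cmPlaneTorusIdeles_inf_eq_archToAdelic, ← cmPairRep_archToAdelic_eq_adelicTensorEnd, map_one]
  rfl

/-! ## § 3 the archimedean factor of the see-saw tensor of two test functions -/

/-- **the archimedean factor of `φ_N(Φ₀) ⊗″ φ_N(Φ₁)`**: the reindexed Schwartz box `R_e^∞ ((R_f^∞)⁻¹ ((R_{e₁}^∞)⁻¹ Φ₀ ⊠_∞ (R_{e₁}^∞)⁻¹ Φ₁))`. -/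
def slotArchBox (Φ₀ Φ₁ : 𝓢((Fin 3 → mixedSpace (↥(NumberField.maximalRealSubfield (L : Type)))), ℂ)) : 𝓢((Fin (3 * 2) → mixedSpace (↥(NumberField.maximalRealSubfield (L : Type)))), ℂ) :=
  schwartzReindexCLM (↥(NumberField.maximalRealSubfield (L : Type))) finProdFinEquiv
    (schwartzReindexCLM (↥(NumberField.maximalRealSubfield (L : Type))) (finProdSumEquiv 3 1 1).symm
      (archBoxTensor (schwartzReindexCLM (↥(NumberField.maximalRealSubfield (L : Type))) e₁.symm Φ₀) (schwartzReindexCLM (↥(NumberField.maximalRealSubfield (L : Type))) e₁.symm Φ₁)))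

/-- **`X = E (slotArchBox Φ₀ Φ₁ ⊗ f)`**: the see-saw tensor of two thin-coset test functions of the same level is a pure tensor
with archimedean factor `slotArchBox Φ₀ Φ₁`. -/
theorem exists_cmLineTensorFin_testFun_eq_tmul (Φ₀ Φ₁ : 𝓢((Fin 3 → mixedSpace (↥(NumberField.maximalRealSubfield (L : Type)))), ℂ)) (x₀ x₁ : Fin 3 → (↥(NumberField.maximalRealSubfield (L : Type)))) (N : ℕ) :
    ∃ f : FinSB (↥(NumberField.maximalRealSubfield (L : Type))) (Fin (3 * 2)),
      (cmLineTensorFin (L : Type) finProdFinEquiv e₁ (frameD V) (frameD_real V) (frameD_ne V) (dW S) (dW_real S) (dW_ne S)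
          (SupplyInstance.testFun (↥(NumberField.maximalRealSubfield (L : Type))) (Fin 3) Φ₀ x₀ N)
          (SupplyInstance.testFun (↥(NumberField.maximalRealSubfield (L : Type))) (Fin 3) Φ₁ x₁ N)) =
        piSchwartzBruhatEquiv (↥(NumberField.maximalRealSubfield (L : Type))) (Fin (3 * 2)) (slotArchBox Φ₀ Φ₁ ⊗ₜ f) := by
  have e : ∀ (Ψ : 𝓢((Fin 3 → mixedSpace (↥(NumberField.maximalRealSubfield (L : Type)))), ℂ)) (x : Fin 3 → (↥(NumberField.maximalRealSubfield (L : Type)))), SupplyInstance.testFun (↥(NumberField.maximalRealSubfield (L : Type))) (Fin 3) Ψ x N =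
      thinCosetTestFunₗ (K := (↥(NumberField.maximalRealSubfield (L : Type)))) (ι := Fin 3) (SupplyInstance.finEmb (↥(NumberField.maximalRealSubfield (L : Type))) (Fin 3) x)
        (Ideal.span {((N : ℕ) : NumberField.RingOfIntegers (↥(NumberField.maximalRealSubfield (L : Type))))}) Ψ := fun _ _ => rfl
  rw [cmLineTensorFin_eq_reindex_tensorToSum, e, e, thinCosetTestFunₗ_eq_tmul, thinCosetTestFunₗ_eq_tmul,
    piSBReindex_symm, piSBReindex_symm, piSBReindex_tmul, piSBReindex_tmul, tensorToSum_tmul, piSBReindex_tmul,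
    piSBReindex_tmul]
  exact ⟨_, rfl⟩

/-! ## § 4 the read-off from an ARCHIMEDEAN eigen-identity -/

/-- **an eigen-identity of `ω_∞(1, archDiag (dW S) (t₀,t₁))` on `slotArchBox Φ₀ Φ₁` IS #1213's hypothesis `h`** (any scalar family `κ`). -/
theorem cmPairRep_planeTorus_lineTensorFin_of_arch_eigen (Φ₀ Φ₁ : 𝓢((Fin 3 → mixedSpace (↥(NumberField.maximalRealSubfield (L : Type)))), ℂ))
    (x₀ x₁ : Fin 3 → (↥(NumberField.maximalRealSubfield (L : Type)))) (N : ℕ) (κ : ↥(relNormOneInfUnits (↥(NumberField.maximalRealSubfield (L : Type))) (L : Type)) → ↥(relNormOneInfUnits (↥(NumberField.maximalRealSubfield (L : Type))) (L : Type)) → ℂ)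
    (harch : ∀ t₀ t₁ : ↥(relNormOneInfUnits (↥(NumberField.maximalRealSubfield (L : Type))) (L : Type)),
      HypCensus.cmArchWeilRep (L : Type) finProdFinEquiv (frameD V) (frameD_real V) (frameD_ne V) (dW S) (dW_real S) (dW_ne S) hGR
          (1, HypCensus.archDiag (L : Type) (dW S) (NumberField.SeesawArchTorus.mk (L : Type) t₀ t₁)) (slotArchBox Φ₀ Φ₁) =
        κ t₀ t₁ • slotArchBox Φ₀ Φ₁)
    (t₀ t₁ : ↥(relNormOneInfUnits (↥(NumberField.maximalRealSubfield (L : Type))) (L : Type))) :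
    cmPairRep (L : Type) finProdFinEquiv (frameD V) (frameD_real V) (frameD_ne V) (dW S) (dW_real S) (dW_ne S) hGR
        (1, cmPlaneTorusIdeles (L : Type) (dW S)
          (relNormOneInfToIdeles (↥(NumberField.maximalRealSubfield (L : Type))) (L : Type) t₀,
            relNormOneInfToIdeles (↥(NumberField.maximalRealSubfield (L : Type))) (L : Type) t₁))
    (cmLineTensorFin (L : Type) finProdFinEquiv e₁ (frameD V) (frameD_real V) (frameD_ne V) (dW S) (dW_real S) (dW_ne S)
          (SupplyInstance.testFun (↥(NumberField.maximalRealSubfield (L : Type))) (Fin 3) Φ₀ x₀ N)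
          (SupplyInstance.testFun (↥(NumberField.maximalRealSubfield (L : Type))) (Fin 3) Φ₁ x₁ N)) =
      κ t₀ t₁ •
    (cmLineTensorFin (L : Type) finProdFinEquiv e₁ (frameD V) (frameD_real V) (frameD_ne V) (dW S) (dW_real S) (dW_ne S)
          (SupplyInstance.testFun (↥(NumberField.maximalRealSubfield (L : Type))) (Fin 3) Φ₀ x₀ N)
          (SupplyInstance.testFun (↥(NumberField.maximalRealSubfield (L : Type))) (Fin 3) Φ₁ x₁ N)) := by
  obtain ⟨f, hX⟩ := exists_cmLineTensorFin_testFun_eq_tmul V S Φ₀ Φ₁ x₀ x₁ N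
  rw [hX, cmPairRep_planeTorus_eq_adelicTensorEnd, adelicTensorEnd_apply_tmul, LinearMap.id_apply]
  erw [harch t₀ t₁]
  rw [← TensorProduct.smul_tmul', map_smul]

/-- **READ-OFF OF BOTH PLANE SLOT TYPES FROM AN ARCHIMEDEAN EIGEN-IDENTITY** (tables `m₀ m₁` arbitrary; `cₖ`, `hctrₖ` as in #1210). -/
theorem slotType_eq_of_arch_eigen
    (Φ₀ Φ₁ : SchwartzMap (Fin 3 → NumberField.mixedEmbedding.mixedSpace (↥(NumberField.maximalRealSubfield (L : Type)))) ℂ)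
    (x₀ x₁ : Fin 3 → ↥(NumberField.maximalRealSubfield (L : Type)))
    (c₀ c₁ : ↥(relNormOneInfUnits (↥(NumberField.maximalRealSubfield (L : Type))) (L : Type)) →* ℂ)
    (hctr₀ : ∀ (N : ℕ) (t : ↥(relNormOneInfUnits (↥(NumberField.maximalRealSubfield (L : Type))) (L : Type))),
      cmPairRep (L : Type) e₁ (frameD V) (frameD_real V) (frameD_ne V) (lineVec (L : Type) (dW S 0)) (fun _ => dW_real S 0)
          (fun _ => dW_ne S 0) hGR₀
          (CMCenter (L : Type) (frameD V)
              ((UnitaryGroup.cmAdelicOneEquivRelNormOne (L : Type)).symm (relNormOneInfToIdeles (↥(NumberField.maximalRealSubfield (L : Type))) (L : Type) t)), 1)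
          (SupplyInstance.testFun (↥(NumberField.maximalRealSubfield (L : Type))) (Fin 3) Φ₀ x₀ N) =
        c₀ t • SupplyInstance.testFun (↥(NumberField.maximalRealSubfield (L : Type))) (Fin 3) Φ₀ x₀ N)
    (hctr₁ : ∀ (N : ℕ) (t : ↥(relNormOneInfUnits (↥(NumberField.maximalRealSubfield (L : Type))) (L : Type))),
      cmPairRep (L : Type) e₁ (frameD V) (frameD_real V) (frameD_ne V) (lineVec (L : Type) (dW S 1)) (fun _ => dW_real S 1)
          (fun _ => dW_ne S 1) hGR₁
          (CMCenter (L : Type) (frameD V)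
              ((UnitaryGroup.cmAdelicOneEquivRelNormOne (L : Type)).symm (relNormOneInfToIdeles (↥(NumberField.maximalRealSubfield (L : Type))) (L : Type) t)), 1)
          (SupplyInstance.testFun (↥(NumberField.maximalRealSubfield (L : Type))) (Fin 3) Φ₁ x₁ N) =
        c₁ t • SupplyInstance.testFun (↥(NumberField.maximalRealSubfield (L : Type))) (Fin 3) Φ₁ x₁ N)
    (hχ₀ : Continuous ⇑(slotChi₀ V S hGR hGR₀ hGR₁ * c₀)) (hχ₁ : Continuous ⇑(slotChi₁ V S hGR hGR₀ hGR₁ * c₁))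
    (hx₀ : Φ₀ (SupplyInstance.archEmb (↥(NumberField.maximalRealSubfield (L : Type))) (Fin 3) x₀) ≠ 0) (hx₁ : Φ₁ (SupplyInstance.archEmb (↥(NumberField.maximalRealSubfield (L : Type))) (Fin 3) x₁) ≠ 0)
    {N : ℕ} (hN : N ≠ 0) (m₀ m₁ : NumberField.InfinitePlace (L : Type) → ℤ)
    (harch : ∀ t₀ t₁ : ↥(relNormOneInfUnits (↥(NumberField.maximalRealSubfield (L : Type))) (L : Type)),
      HypCensus.cmArchWeilRep (L : Type) finProdFinEquiv (frameD V) (frameD_real V) (frameD_ne V) (dW S) (dW_real S) (dW_ne S) hGR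
          (1, HypCensus.archDiag (L : Type) (dW S) (NumberField.SeesawArchTorus.mk (L : Type) t₀ t₁)) (slotArchBox Φ₀ Φ₁) =
        (archWeight (L : Type) m₀ t₀ * archWeight (L : Type) m₁ t₁) • slotArchBox Φ₀ Φ₁) :
    slotType (L := L) (slotChi₀ V S hGR hGR₀ hGR₁ * c₀) hχ₀ = m₀ ∧ slotType (L := L) (slotChi₁ V S hGR hGR₀ hGR₁ * c₁) hχ₁ = m₁ :=
  slotType_eq_of_planeTorus_eigen V S hGR hGR₀ hGR₁ Φ₀ Φ₁ x₀ x₁ c₀ c₁ hctr₀ hctr₁ hχ₀ hχ₁ hx₀ hx₁ hN hN m₀ m₁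
    (cmPairRep_planeTorus_lineTensorFin_of_arch_eigen V S hGR Φ₀ Φ₁ x₀ x₁ N
      (fun t₀ t₁ => archWeight (L : Type) m₀ t₀ * archWeight (L : Type) m₁ t₁) harch)

end Plane

/-! ## § 5 family level: `slotTypeVec 1 − slotTypeVec 0` from the archimedean eigen-identity at (F1)'s slot vectors -/

section Vec

variable {L : CMField} {ι₁ : L →+* ℂ} (V : HermSpace3 L ι₁) (c : SeesawCtx L)
variable
  (hGR : (cmSplittingDatum (L : Type) finProdFinEquiv (frameD V) (frameD_real V) (frameD_ne V) (dW c.D) (dW_real c.D) (dW_ne c.D)).CompatibleSplitting)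
  (hGR₀ : (cmSplittingDatum (L : Type) (e₁) (frameD V) (frameD_real V) (frameD_ne V) (lineVec (L : Type) (dW c.D 0))
    (fun _ => dW_real c.D 0) (fun _ => dW_ne c.D 0)).CompatibleSplitting)
  (hGR₁ : (cmSplittingDatum (L : Type) (e₁) (frameD V) (frameD_real V) (frameD_ne V) (lineVec (L : Type) (dW c.D 1))
    (fun _ => dW_real c.D 1) (fun _ => dW_ne c.D 1)).CompatibleSplitting)
  (hGR₂ : (cmSplittingDatum (L : Type) (e₁) (frameD V) (frameD_real V) (frameD_ne V) (lineVec (L : Type) (dW' c.D 0))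
    (fun _ => dW'_real c.D 0) (fun _ => dW'_ne c.D 0)).CompatibleSplitting)
  (hGR₃ : (cmSplittingDatum (L : Type) (e₁) (frameD V) (frameD_real V) (frameD_ne V) (lineVec (L : Type) (dW' c.D 1))
    (fun _ => dW'_real c.D 1) (fun _ => dW'_ne c.D 1)).CompatibleSplitting)
  (h₁W : (∀ j, 0 < (ι₁ (dW c.D j)).re) ∨ ∀ j, (ι₁ (dW c.D j)).re < 0)
  (hpos₀ : 0 < HypCensus.cmXW (L : Type) (frameD V) (lineVec (L : Type) (dW c.D 0)) (fun _ => dW_real c.D 0) ι₁ (HypCensus.cmPlace (L : Type) ι₁) 0)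
  (hpos₁ : 0 < HypCensus.cmXW (L : Type) (frameD V) (lineVec (L : Type) (dW c.D 1)) (fun _ => dW_real c.D 1) ι₁ (HypCensus.cmPlace (L : Type) ι₁) 0)

/-- **the archimedean slot box of the context**: `slotArchBox (linePhi₀) (linePhi₁)` — the vector binder-2's engine acts on. -/
abbrev ctxSlotArchBox : 𝓢((Fin (3 * 2) → mixedSpace (↥(NumberField.maximalRealSubfield (L : Type)))), ℂ) :=
  slotArchBox (linePhi V (dW c.D 0) (dW_real c.D 0) (dW_ne c.D 0) hpos₀) (linePhi V (dW c.D 1) (dW_real c.D 1) (dW_ne c.D 1) hpos₁)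

/-- **`hΔ₁` FROM AN ARCHIMEDEAN EIGEN-IDENTITY**: if `ω_∞(1, archDiag (dW c.D) (t₀,t₁))` acts on the slot box of the context by
`archWeight m₀ t₀ · archWeight m₁ t₁`, then `slotTypeVec 1 − slotTypeVec 0 = m₁ − m₀`. -/
theorem slotTypeVec_sub_eq_of_arch_eigen (m₀ m₁ : NumberField.InfinitePlace (L : Type) → ℤ)
    (harch : ∀ t₀ t₁ : ↥(relNormOneInfUnits (↥(NumberField.maximalRealSubfield (L : Type))) (L : Type)),
      HypCensus.cmArchWeilRep (L : Type) finProdFinEquiv (frameD V) (frameD_real V) (frameD_ne V) (dW c.D) (dW_real c.D) (dW_ne c.D) hGR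
          (1, HypCensus.archDiag (L : Type) (dW c.D) (NumberField.SeesawArchTorus.mk (L : Type) t₀ t₁)) (ctxSlotArchBox V c hpos₀ hpos₁) =
        (archWeight (L : Type) m₀ t₀ * archWeight (L : Type) m₁ t₁) • ctxSlotArchBox V c hpos₀ hpos₁) :
    slotTypeVec V c hGR hGR₀ hGR₁ hGR₂ hGR₃ h₁W 1 - slotTypeVec V c hGR hGR₀ hGR₁ hGR₂ hGR₃ h₁W 0 = m₁ - m₀ :=
  slotTypeVec_sub_eq_of_planeTorus_eigen V c hGR hGR₀ hGR₁ hGR₂ hGR₃ h₁W hpos₀ hpos₁ one_ne_zero one_ne_zero m₀ m₁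
    (cmPairRep_planeTorus_lineTensorFin_of_arch_eigen V c.D hGR
      (linePhi V (dW c.D 0) (dW_real c.D 0) (dW_ne c.D 0) hpos₀) (linePhi V (dW c.D 1) (dW_real c.D 1) (dW_ne c.D 1) hpos₁)
      (lineX₀ V (dW c.D 0) (dW_real c.D 0) (dW_ne c.D 0) hpos₀) (lineX₀ V (dW c.D 1) (dW_real c.D 1) (dW_ne c.D 1) hpos₁) 1
      (fun t₀ t₁ => archWeight (L : Type) m₀ t₀ * archWeight (L : Type) m₁ t₁) harch)

end Vec

end HodgeCM.Model.ArchSideTerm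

end
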